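import Literature.Computability.Cryptography.RegevVerificationTestApprox
import Mathlib.Analysis.Real.Pi.Bounds
import Mathlib.Analysis.Complex.ExponentialBounds
import HarnessLib

/-!
# An exactly computable readout for Regev's verification test: `cos(2πx)` to within `1/1000` by rational operations

Topic `Computability/Cryptography` (family `pqc`), grouping namespace `Regev2009`; sequel of
`RegevVerificationTestApprox.lean` (Lemma 3.6 survives for any readout `g` of the residual with
`|g - cos| ≤ η`, `|g| ≤ 1`, `η ≤ e^{-πα²}/8`). Everything here is PROVED; the definitions have bodies;
no named fact.

The readout a MACHINE evaluates: `cosReadout Q k = cosTurn(val k / Q)` where `cosTurn` computes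
`cos(2πx)` for `x ∈ [0, 1]` using only `+, -, ×, /`, comparisons and the rational constant
`π̃ = 3.1415925`: range reduction to `t ∈ [0, 1/4]` (`cos(2πx) = cos(2π(1-x)) = -cos(2π(½-x))`), the
quadratic Taylor value `1 - (π̃t/16)²/2 ≈ cos(πt/16)` (`Real.cos_bound`, angle `≤ π/64`), five doublings
`c ↦ 2c² - 1` (`cos 2θ = 2cos²θ - 1`, each multiplying the error by `≤ 4.02`), and a final clamp to
`[-1, 1]`. So on a residue `k` the machine's value is the rational number `cosTurn(k/Q)` EXACTLY, and

* `abs_cosTurn_sub_cos_le` — `|cosTurn x - cos(2πx)| ≤ 1/1000` on `[0, 1]`; `abs_cosTurn_le_one`;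
* `abs_cosReadout_sub_le`, `abs_cosReadout_le_one` — the hypotheses `hg`, `hB` of
  `RegevVerificationTestApprox.lean` with `η = 1/1000`;
* `one_div_thousand_le_exp_div_eight` — `1/1000 ≤ e^{-πα²}/8` for `|α| ≤ 1` (`e^π < e⁴ < 55`), the
  hypothesis `hη` there;
* the THRESHOLD, likewise by rational operations: `expNegSmall` (degree-9 Taylor value of `e^{-y}`,
  `y ∈ [0, 1]`, `Real.exp_bound`), `expNegApprox x = expNegSmall(x/4)⁴ ≈ e^{-x}` on `[0, 4]`
  (`abs_expNegApprox_sub_le`: error `≤ 10⁻⁵`), `thresholdReadout α = (15/32)·expNegApprox(π̃α²)` with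
  **`thresholdReadout_mem_window`**: `(7/16)e^{-πα²} ≤ thresholdReadout α ≤ e^{-πα²}/2` for `|α| ≤ 1`;
* `toReal_acceptStat_of_ne_le_window`, `toReal_rejectStat_self_le_window` — Lemma 3.6 for ANY threshold
  in that window and any readout `η`-close to the cosine with `η ≤ e^{-πα²}/16` (`|g| ≤ 1`):
  `Pr[accept s' ≠ s] ≤ exp(-N e^{-2πα²}/64)`, `Pr[reject s] ≤ exp(-N e^{-2πα²}/256)`; with
  `one_div_thousand_le_exp_div_sixteen` (`1/1000 ≤ e^{-πα²}/16`) these are the `(η_A, η_R)` of a machine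
  running the test `acceptSetStat (cosReadout) N (thresholdReadout α)` — everything it compares is rational. Hence a machine running Regev's test with `cosReadout` has the error bounds
  `(η_A, η_R) = (e^{-N e^{-2πα²}/64}, e^{-N e^{-2πα²}/512})` (`toReal_acceptStat_of_ne_le_exp`,
  `toReal_rejectStat_self_le_exp`) required by `Regev2009.regevBDD` /
  `Peikert2009.regevBDD_solves_eventually_of_test`.

## References

* O. Regev, *On lattices, learning with errors, random linear codes, and cryptography*, J. ACM 56
  (2009), art. 34, Lemma 3.6 (proof: "we estimate `z̃` … using, say, `n` samples") [RegevLWE2009].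
* C. Peikert, *Public-key cryptosystems from the worst-case shortest vector problem*, STOC 2009, full
  version p. 7 ("a suitable amount of precision") [Peikert2009].
-/

noncomputable section

open Real

namespace Literature.Computability.Cryptography

namespace Regev2009

/-! ### Constants and the doubling step -/

/-- LOCAL GLUE. The rational constant `π̃ = 3.1415925` used in place of `π`. [folklore] -/
def piQ : ℝ := 3.1415925

/-- `|π - π̃| ≤ 10⁻⁶`. [folklore] -/
theorem abs_pi_sub_piQ : |π - piQ| ≤ 1 / 1000000 := by
  rw [piQ, abs_le]
  constructor <;> nlinarith [Real.pi_gt_d6, Real.pi_lt_d6]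

/-- LOCAL GLUE. The doubling step `c ↦ 2c² - 1` (`cos 2θ = 2cos²θ - 1`). [folklore] -/
def dbl (c : ℝ) : ℝ := 2 * c ^ 2 - 1

/-- **Error propagation through a doubling**: if `|c - cos θ| ≤ e ≤ 1/100` then
`|dbl c - cos 2θ| ≤ 4.02·e` (`2(c² - cos²θ) = 2(c - cos θ)(c + cos θ)`, `|c + cos θ| ≤ 2 + e`). [folklore] -/
theorem abs_dbl_sub_cos_le {c θ e : ℝ} (h : |c - Real.cos θ| ≤ e) (he : e ≤ 1 / 100) :
    |dbl c - Real.cos (2 * θ)| ≤ 201 / 50 * e := by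
  have he0 : 0 ≤ e := (abs_nonneg _).trans h
  have hcos := Real.abs_cos_le_one θ
  have h1 : dbl c - Real.cos (2 * θ) = 2 * (c - Real.cos θ) * (c + Real.cos θ) := by
    rw [dbl, Real.cos_two_mul]; ring
  have h2 : |c + Real.cos θ| ≤ e + 2 := by
    calc |c + Real.cos θ| = |(c - Real.cos θ) + 2 * Real.cos θ| := by ring_nf
      _ ≤ |c - Real.cos θ| + |2 * Real.cos θ| := abs_add_le _ _
      _ ≤ e + 2 := by rw [abs_mul, abs_two]; linarith
  rw [h1, abs_mul, abs_mul, abs_two]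
  calc 2 * |c - Real.cos θ| * |c + Real.cos θ| ≤ 2 * e * (e + 2) := by gcongr
    _ ≤ 201 / 50 * e := by nlinarith

/-! ### The small angle and five doublings -/

/-- LOCAL GLUE. `1 - (π̃t/16)²/2 ≈ cos(πt/16)`. [folklore] -/
def cosSmall (t : ℝ) : ℝ := 1 - (piQ * t / 16) ^ 2 / 2

/-- For `|t| ≤ 1/4`: `|cosSmall t - cos(πt/16)| ≤ 5·10⁻⁷` (`Real.cos_bound` at the angle `π̃t/16 ≤ 0.05`,
plus `|cos(π̃t/16) - cos(πt/16)| ≤ |π̃ - π|/64`). [folklore] -/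
theorem abs_cosSmall_sub_le {t : ℝ} (ht : |t| ≤ 1 / 4) :
    |cosSmall t - Real.cos (π * t / 16)| ≤ 1 / 2000000 := by
  have hpiQ : |piQ| ≤ 3.15 := by rw [piQ]; norm_num [abs_of_pos]
  have hz : |piQ * t / 16| ≤ 1 / 20 := by
    rw [abs_div, abs_mul, abs_of_pos (by norm_num : (0:ℝ) < 16)]
    nlinarith [abs_nonneg t, abs_nonneg piQ]
  have hz1 : |piQ * t / 16| ≤ 1 := hz.trans (by norm_num)
  have h1 := Real.cos_bound hz1
  have h2 : |piQ * t / 16| ^ 4 * (5 / 96) ≤ 1 / 3000000 := by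
    have h4 : |piQ * t / 16| ^ 4 ≤ (1 / 20) ^ 4 := pow_le_pow_left₀ (abs_nonneg _) hz 4
    nlinarith
  have h3 : |Real.cos (piQ * t / 16) - Real.cos (π * t / 16)| ≤ 1 / 10000000 := by
    refine (Real.abs_cos_sub_cos_le _ _).trans ?_
    rw [show piQ * t / 16 - π * t / 16 = (piQ - π) * (t / 16) by ring, abs_mul]
    have hp : |piQ - π| ≤ 1 / 1000000 := by rw [abs_sub_comm]; exact abs_pi_sub_piQ
    have ht' : |t / 16| ≤ 1 / 64 := by rw [abs_div, abs_of_pos (by norm_num : (0:ℝ) < 16)]; linarith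
    calc |piQ - π| * |t / 16| ≤ 1 / 1000000 * (1 / 64) :=
          mul_le_mul hp ht' (abs_nonneg _) (by norm_num)
      _ ≤ 1 / 10000000 := by norm_num
  calc |cosSmall t - Real.cos (π * t / 16)|
      = |(Real.cos (piQ * t / 16) - Real.cos (π * t / 16)) - (Real.cos (piQ * t / 16) - cosSmall t)| := by
        ring_nf
    _ ≤ |Real.cos (piQ * t / 16) - Real.cos (π * t / 16)| + |Real.cos (piQ * t / 16) - cosSmall t| :=
        abs_sub _ _
    _ ≤ 1 / 10000000 + 1 / 3000000 := add_le_add h3 (by rw [cosSmall]; exact h1.trans h2)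
    _ ≤ 1 / 2000000 := by norm_num

/-- LOCAL GLUE. `cos(2πt)` for `|t| ≤ 1/4`: five doublings of the small-angle value
(`πt/16 → πt/8 → πt/4 → πt/2 → πt → 2πt`). [folklore] -/
def cosQuarter (t : ℝ) : ℝ := dbl (dbl (dbl (dbl (dbl (cosSmall t)))))

/-- For `|t| ≤ 1/4`: `|cosQuarter t - cos(2πt)| ≤ 1/1800` (`5·10⁻⁷ × 4.02⁵ ≈ 5.3·10⁻⁴`). [folklore] -/
theorem abs_cosQuarter_sub_le {t : ℝ} (ht : |t| ≤ 1 / 4) :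
    |cosQuarter t - Real.cos (2 * π * t)| ≤ 1 / 1800 := by
  have h0 := abs_cosSmall_sub_le ht
  have h1 := abs_dbl_sub_cos_le h0 (by norm_num)
  rw [show 2 * (π * t / 16) = π * t / 8 by ring] at h1
  have h2 := abs_dbl_sub_cos_le h1 (by norm_num)
  rw [show 2 * (π * t / 8) = π * t / 4 by ring] at h2
  have h3 := abs_dbl_sub_cos_le h2 (by norm_num)
  rw [show 2 * (π * t / 4) = π * t / 2 by ring] at h3
  have h4 := abs_dbl_sub_cos_le h3 (by norm_num)
  rw [show 2 * (π * t / 2) = π * t by ring] at h4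
  have h5 := abs_dbl_sub_cos_le h4 (by norm_num)
  rw [show 2 * (π * t) = 2 * π * t by ring] at h5
  exact h5.trans (by norm_num)

/-! ### Clamp, range reduction, and the readout -/

/-- LOCAL GLUE. The clamp to `[-1, 1]`. [folklore] -/
def clamp (c : ℝ) : ℝ := max (-1) (min 1 c)

/-- `|clamp c| ≤ 1`. [folklore] -/
theorem abs_clamp_le_one (c : ℝ) : |clamp c| ≤ 1 := by
  rw [clamp, abs_le]
  constructor
  · exact le_max_left _ _
  · exact max_le (by norm_num) (min_le_left _ _)

/-- Clamping does not increase the distance to a point of `[-1, 1]`. [folklore] -/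
theorem abs_clamp_sub_le {c y : ℝ} (hy : |y| ≤ 1) : |clamp c - y| ≤ |c - y| := by
  obtain ⟨hy1, hy2⟩ := abs_le.1 hy
  rw [clamp]
  rcases le_total c 1 with hc1 | hc1
  · rw [min_eq_right hc1]
    rcases le_total (-1) c with hc2 | hc2
    · rw [max_eq_right hc2]
    · rw [max_eq_left hc2, abs_le]
      have := abs_le.1 (le_refl |c - y|)
      constructor <;> nlinarith [abs_nonneg (c - y), le_abs_self (y - c), abs_sub_comm c y]
  · rw [min_eq_left hc1, max_eq_right (by norm_num : (-1 : ℝ) ≤ 1), abs_le]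
    constructor <;> nlinarith [abs_nonneg (c - y), le_abs_self (c - y)]

/-- LOCAL GLUE. **The turn-cosine** `cosTurn x ≈ cos(2πx)` for `x ∈ [0, 1]`, by rational operations only:
fold `x ↦ 1 - x` onto `[0, ½]`, then `cos(2πy) = -cos(2π(½ - y))` onto `[0, ¼]`, then `cosQuarter`,
then clamp. (A machine evaluates exactly this on the rational `x = k/Q`.) [cite: RegevLWE2009, Lemma 3.6 (proof: the statistic `cos(2πy)`)] -/
def cosTurn (x : ℝ) : ℝ :=
  clamp (if (if x ≤ 1 / 2 then x else 1 - x) ≤ 1 / 4 then cosQuarter (if x ≤ 1 / 2 then x else 1 - x)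
    else -cosQuarter (1 / 2 - (if x ≤ 1 / 2 then x else 1 - x)))

/-- `|cosTurn x| ≤ 1`. [folklore] -/
theorem abs_cosTurn_le_one (x : ℝ) : |cosTurn x| ≤ 1 := abs_clamp_le_one _

/-- **`|cosTurn x - cos(2πx)| ≤ 1/1000` on `[0, 1]`.** [folklore] -/
theorem abs_cosTurn_sub_cos_le {x : ℝ} (hx0 : 0 ≤ x) (hx1 : x ≤ 1) :
    |cosTurn x - Real.cos (2 * π * x)| ≤ 1 / 1000 := by
  -- fold onto `y ∈ [0, ½]` with the same cosine
  set y : ℝ := if x ≤ 1 / 2 then x else 1 - x with hy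
  have hy0 : 0 ≤ y := by rw [hy]; split_ifs <;> linarith
  have hy1 : y ≤ 1 / 2 := by rw [hy]; split_ifs <;> linarith
  have hcy : Real.cos (2 * π * y) = Real.cos (2 * π * x) := by
    rw [hy]; split_ifs with h
    · rfl
    · rw [show 2 * π * (1 - x) = -(2 * π * x) + (1 : ℤ) * (2 * π) by ring, Real.cos_add_int_mul_two_pi,
        Real.cos_neg]
  rw [cosTurn, ← hy, ← hcy]
  refine (abs_clamp_sub_le (Real.abs_cos_le_one _)).trans ?_
  split_ifs with h
  · exact (abs_cosQuarter_sub_le (by rw [abs_of_nonneg hy0]; exact h)).trans (by norm_num)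
  · -- `cos(2πy) = -cos(2π(½ - y))`, `½ - y ∈ [0, ¼)`
    push Not at h
    have ht : |1 / 2 - y| ≤ 1 / 4 := by rw [abs_of_nonneg (by linarith)]; linarith
    have hq := abs_cosQuarter_sub_le ht
    have hneg : Real.cos (2 * π * y) = -Real.cos (2 * π * (1 / 2 - y)) := by
      rw [show 2 * π * (1 / 2 - y) = π - 2 * π * y by ring, Real.cos_pi_sub, neg_neg]
    rw [hneg, show -cosQuarter (1 / 2 - y) - -Real.cos (2 * π * (1 / 2 - y)) =
      -(cosQuarter (1 / 2 - y) - Real.cos (2 * π * (1 / 2 - y))) by ring, abs_neg]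
    exact hq.trans (by norm_num)

/-- LOCAL GLUE. **The machine's readout of a fine residue**: `cosReadout Q k = cosTurn(val k / Q)`.
[cite: RegevLWE2009, Lemma 3.6 (proof)] -/
def cosReadout (Q : ℕ) [NeZero Q] (k : ZMod Q) : ℝ := cosTurn ((k.val : ℝ) / Q)

/-- `|cosReadout k - cos(2πk/Q)| ≤ 1/1000`, with `cos(2πk/Q) = Re e^{2πik/Q}` (hypothesis `hg` of
`RegevVerificationTestApprox.lean` with `η = 1/1000`). [folklore] -/
theorem abs_cosReadout_sub_le (Q : ℕ) [NeZero Q] (k : ZMod Q) :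
    |cosReadout Q k - ((ZMod.toCircle k : Circle) : ℂ).re| ≤ 1 / 1000 := by
  have hQ : (0 : ℝ) < Q := Nat.cast_pos.2 (Nat.pos_of_ne_zero (NeZero.ne Q))
  have hre : ((ZMod.toCircle k : Circle) : ℂ).re = Real.cos (2 * π * ((k.val : ℝ) / Q)) := by
    rw [ZMod.toCircle_apply]
    have h : (2 * π * Complex.I * (k.val : ℂ) / (Q : ℂ)) = ((2 * π * ((k.val : ℝ) / Q) : ℝ) : ℂ) * Complex.I := by
      push_cast; ring
    rw [h, Complex.exp_ofReal_mul_I_re]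
  rw [hre, cosReadout]
  exact abs_cosTurn_sub_cos_le (by positivity)
    ((div_le_one hQ).2 (by exact_mod_cast (ZMod.val_lt k).le))

/-- `|cosReadout k| ≤ 1` (hypothesis `hB`). [folklore] -/
theorem abs_cosReadout_le_one (Q : ℕ) [NeZero Q] (k : ZMod Q) : |cosReadout Q k| ≤ 1 := abs_cosTurn_le_one _

/-- `1/1000 ≤ e^{-πα²}/8` for `|α| ≤ 1` (`e^{πα²} ≤ e^π ≤ e⁴ < 55 ≤ 125`; hypothesis `hη`). [folklore] -/
theorem one_div_thousand_le_exp_div_eight {α : ℝ} (hα : |α| ≤ 1) :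
    (1 : ℝ) / 1000 ≤ Real.exp (-(π * α ^ 2)) / 8 := by
  have hα2 : α ^ 2 ≤ 1 := by
    have h := pow_le_one₀ (abs_nonneg α) hα (n := 2)
    rwa [sq_abs] at h
  have h1 : Real.exp (π * α ^ 2) ≤ Real.exp 4 :=
    Real.exp_le_exp.2 (by nlinarith [Real.pi_le_four, Real.pi_pos, sq_nonneg α])
  have h4 : Real.exp 4 < 55 := by
    have h : Real.exp 4 = Real.exp 1 ^ 4 := by rw [← Real.exp_nat_mul]; norm_num
    rw [h]
    have h1 := Real.exp_one_lt_d9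
    have h0 : 0 < Real.exp 1 := Real.exp_pos 1
    calc Real.exp 1 ^ 4 < (2.7182818286 : ℝ) ^ 4 := by gcongr
      _ < 55 := by norm_num
  have hpos : 0 < Real.exp (π * α ^ 2) := Real.exp_pos _
  have h55 : (1 : ℝ) / 55 ≤ (Real.exp (π * α ^ 2))⁻¹ := by
    rw [one_div]
    exact inv_anti₀ hpos (h1.trans h4.le)
  rw [Real.exp_neg]
  linarith

/-! ### The threshold by rational operations: `e^{-πα²}` to within a factor `1 ± 1/64` -/

/-- LOCAL GLUE. Degree-9 Taylor value of `e^{-y}` (`y ∈ [0, 1]`). [folklore] -/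
def expNegSmall (y : ℝ) : ℝ := ∑ m ∈ Finset.range 10, (-y) ^ m / m.factorial

/-- `|expNegSmall y - e^{-y}| ≤ 5·10⁻⁷` for `y ∈ [0, 1]` (`Real.exp_bound`). [folklore] -/
theorem abs_expNegSmall_sub_le {y : ℝ} (hy0 : 0 ≤ y) (hy1 : y ≤ 1) :
    |expNegSmall y - Real.exp (-y)| ≤ 1 / 2000000 := by
  have hy : |(-y)| ≤ 1 := by rw [abs_neg, abs_of_nonneg hy0]; exact hy1
  have h := Real.exp_bound hy (n := 10) (by norm_num)
  rw [abs_sub_comm, expNegSmall]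
  refine h.trans ?_
  have h10 : |(-y)| ^ 10 ≤ 1 := pow_le_one₀ (abs_nonneg _) hy
  have hc : ((Nat.succ 10 : ℕ) : ℝ) / ((Nat.factorial 10 : ℕ) * (10 : ℕ)) ≤ 1 / 2000000 := by
    norm_num [Nat.factorial]
  calc |(-y)| ^ 10 * ((Nat.succ 10 : ℕ) / ((Nat.factorial 10 : ℕ) * (10 : ℕ)) : ℝ)
      ≤ 1 * (1 / 2000000) := mul_le_mul h10 hc (by positivity) zero_le_one
    _ = 1 / 2000000 := one_mul _

/-- LOCAL GLUE. `e^{-x} ≈ expNegSmall(x/4)⁴` for `x ∈ [0, 4]`. [folklore] -/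
def expNegApprox (x : ℝ) : ℝ := expNegSmall (x / 4) ^ 4

/-- `|a⁴ - b⁴| ≤ 4M³|a - b|` for `|a|, |b| ≤ M`. [folklore] -/
theorem abs_pow_four_sub_le {a b M : ℝ} (ha : |a| ≤ M) (hb : |b| ≤ M) :
    |a ^ 4 - b ^ 4| ≤ 4 * M ^ 3 * |a - b| := by
  have hM : 0 ≤ M := (abs_nonneg a).trans ha
  have h : a ^ 4 - b ^ 4 = (a - b) * (a ^ 3 + a ^ 2 * b + a * b ^ 2 + b ^ 3) := by ring
  rw [h, abs_mul, mul_comm]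
  refine mul_le_mul_of_nonneg_right ?_ (abs_nonneg _)
  have ha3 : |a| ^ 3 ≤ M ^ 3 := pow_le_pow_left₀ (abs_nonneg _) ha 3
  have hb3 : |b| ^ 3 ≤ M ^ 3 := pow_le_pow_left₀ (abs_nonneg _) hb 3
  have hab1 : |a| ^ 2 * |b| ≤ M ^ 3 := by
    calc |a| ^ 2 * |b| ≤ M ^ 2 * M := mul_le_mul (pow_le_pow_left₀ (abs_nonneg _) ha 2) hb (abs_nonneg _) (by positivity)
      _ = M ^ 3 := by ring
  have hab2 : |a| * |b| ^ 2 ≤ M ^ 3 := by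
    calc |a| * |b| ^ 2 ≤ M * M ^ 2 := mul_le_mul ha (pow_le_pow_left₀ (abs_nonneg _) hb 2) (by positivity) hM
      _ = M ^ 3 := by ring
  calc |a ^ 3 + a ^ 2 * b + a * b ^ 2 + b ^ 3|
      ≤ |a ^ 3| + |a ^ 2 * b| + |a * b ^ 2| + |b ^ 3| := by
        refine (abs_add_le _ _).trans (add_le_add ((abs_add_le _ _).trans (add_le_add (abs_add_le _ _) le_rfl)) le_rfl)
    _ = |a| ^ 3 + |a| ^ 2 * |b| + |a| * |b| ^ 2 + |b| ^ 3 := by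
        rw [abs_pow, abs_mul, abs_pow, abs_mul, abs_pow, abs_pow]
    _ ≤ M ^ 3 + M ^ 3 + M ^ 3 + M ^ 3 := by linarith
    _ = 4 * M ^ 3 := by ring

/-- **`|expNegApprox x - e^{-x}| ≤ 10⁻⁵` on `[0, 4]`.** [folklore] -/
theorem abs_expNegApprox_sub_le {x : ℝ} (hx0 : 0 ≤ x) (hx4 : x ≤ 4) :
    |expNegApprox x - Real.exp (-x)| ≤ 1 / 100000 := by
  have hy0 : 0 ≤ x / 4 := by positivity
  have hy1 : x / 4 ≤ 1 := by linarith
  have h0 := abs_expNegSmall_sub_le hy0 hy1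
  have hexp : Real.exp (-x) = Real.exp (-(x / 4)) ^ 4 := by
    rw [← Real.exp_nat_mul]; ring_nf
  have hb : |Real.exp (-(x / 4))| ≤ 1.001 := by
    rw [abs_of_pos (Real.exp_pos _)]
    have : Real.exp (-(x / 4)) ≤ 1 := by rw [Real.exp_le_one_iff]; linarith
    linarith
  have ha : |expNegSmall (x / 4)| ≤ 1.001 := by
    have h1 : |expNegSmall (x / 4)| ≤ |Real.exp (-(x / 4))| + |expNegSmall (x / 4) - Real.exp (-(x / 4))| := by
      have := abs_add_le (Real.exp (-(x / 4))) (expNegSmall (x / 4) - Real.exp (-(x / 4)))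
      rwa [add_sub_cancel] at this
    have hb1 : |Real.exp (-(x / 4))| ≤ 1 := by
      rw [abs_of_pos (Real.exp_pos _), Real.exp_le_one_iff]; linarith
    linarith
  rw [expNegApprox, hexp]
  calc |expNegSmall (x / 4) ^ 4 - Real.exp (-(x / 4)) ^ 4|
      ≤ 4 * (1.001 : ℝ) ^ 3 * |expNegSmall (x / 4) - Real.exp (-(x / 4))| := abs_pow_four_sub_le ha hb
    _ ≤ 4 * (1.001 : ℝ) ^ 3 * (1 / 2000000) := by gcongr
    _ ≤ 1 / 100000 := by norm_num

/-- LOCAL GLUE. **The machine's threshold**: `θ̃_α = (15/32)·expNegApprox(π̃α²)`, a rational function of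
the (rational) noise rate `α`. [cite: RegevLWE2009, Lemma 3.6 (proof: threshold `0.02`)] -/
def thresholdReadout (α : ℝ) : ℝ := 15 / 32 * expNegApprox (piQ * α ^ 2)

/-- **The threshold lies in the window `[(7/16)e^{-πα²}, e^{-πα²}/2]`** for `|α| ≤ 1`
(`|expNegApprox(π̃α²) - e^{-πα²}| ≤ 10⁻⁵ + 10⁻⁶ ≤ e^{-πα²}/64`, since `e^{-πα²} ≥ e^{-4} ≥ 1/55`). [folklore] -/
theorem thresholdReadout_mem_window {α : ℝ} (hα : |α| ≤ 1) :
    7 / 16 * Real.exp (-(π * α ^ 2)) ≤ thresholdReadout α ∧ thresholdReadout α ≤ Real.exp (-(π * α ^ 2)) / 2 := by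
  have hα2 : α ^ 2 ≤ 1 := by
    have h := pow_le_one₀ (abs_nonneg α) hα (n := 2)
    rwa [sq_abs] at h
  have hα20 : 0 ≤ α ^ 2 := sq_nonneg α
  have hpiQ : (0 : ℝ) ≤ piQ ∧ piQ ≤ 3.15 := by rw [piQ]; norm_num
  have hx0 : 0 ≤ piQ * α ^ 2 := mul_nonneg hpiQ.1 hα20
  have hx4 : piQ * α ^ 2 ≤ 4 := by nlinarith
  have h1 := abs_expNegApprox_sub_le hx0 hx4
  -- `|e^{-π̃α²} - e^{-πα²}| ≤ |π̃ - π| α² ≤ 10⁻⁶`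
  have h2 : |Real.exp (-(piQ * α ^ 2)) - Real.exp (-(π * α ^ 2))| ≤ 1 / 1000000 := by
    -- `|e^{-a} - e^{-b}| ≤ |a - b|` for `a, b ≥ 0` (the tree has this as
    -- `Literature.NumberTheory.LFunctions.abs_exp_neg_sub_exp_neg_le`, whose import closure — Gaussian
    -- Fourier analysis — is not wanted here; the elementary argument `1 - e^{-t} ≤ t` is inlined)
    have hlip : ∀ {a b : ℝ}, 0 ≤ a → 0 ≤ b → |Real.exp (-a) - Real.exp (-b)| ≤ |a - b| := by
      have key : ∀ {u v : ℝ}, 0 ≤ u → u ≤ v → Real.exp (-u) - Real.exp (-v) ≤ v - u := by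
        intro u v hu huv
        have h1 : Real.exp (-v) = Real.exp (-u) * Real.exp (-(v - u)) := by rw [← Real.exp_add]; ring_nf
        have h2 : 1 - (v - u) ≤ Real.exp (-(v - u)) := by
          have := Real.add_one_le_exp (-(v - u)); linarith
        have h3 : Real.exp (-u) ≤ 1 := by rw [Real.exp_le_one_iff]; linarith
        have h4 : 0 < Real.exp (-u) := Real.exp_pos _
        rw [h1]
        nlinarith [mul_le_mul_of_nonneg_left h2 h4.le]
      intro a b ha hb
      rcases le_total a b with hab | hab
      · have hpos : 0 ≤ Real.exp (-a) - Real.exp (-b) := by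
          have := Real.exp_le_exp.2 (neg_le_neg hab); linarith
        rw [abs_of_nonneg hpos, abs_sub_comm, abs_of_nonneg (by linarith)]
        exact key ha hab
      · have hpos : 0 ≤ Real.exp (-b) - Real.exp (-a) := by
          have := Real.exp_le_exp.2 (neg_le_neg hab); linarith
        rw [abs_sub_comm, abs_of_nonneg hpos, abs_of_nonneg (by linarith)]
        exact key hb hab
    refine (hlip hx0 (by positivity)).trans ?_
    rw [show piQ * α ^ 2 - π * α ^ 2 = (piQ - π) * α ^ 2 by ring, abs_mul, abs_of_nonneg hα20]
    have hp : |piQ - π| ≤ 1 / 1000000 := by rw [abs_sub_comm]; exact abs_pi_sub_piQ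
    calc |piQ - π| * α ^ 2 ≤ 1 / 1000000 * 1 := mul_le_mul hp hα2 hα20 (by norm_num)
      _ = 1 / 1000000 := mul_one _
  have herr : |expNegApprox (piQ * α ^ 2) - Real.exp (-(π * α ^ 2))| ≤ 11 / 1000000 := by
    calc |expNegApprox (piQ * α ^ 2) - Real.exp (-(π * α ^ 2))|
        = |(expNegApprox (piQ * α ^ 2) - Real.exp (-(piQ * α ^ 2))) +
            (Real.exp (-(piQ * α ^ 2)) - Real.exp (-(π * α ^ 2)))| := by ring_nf
      _ ≤ _ := abs_add_le _ _
      _ ≤ 1 / 100000 + 1 / 1000000 := add_le_add h1 h2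
      _ = 11 / 1000000 := by norm_num
  -- `E = e^{-πα²} ≥ 1/55`
  have hE : (1 : ℝ) / 55 ≤ Real.exp (-(π * α ^ 2)) := by
    have h8 := one_div_thousand_le_exp_div_eight hα
    have h1' : Real.exp (π * α ^ 2) ≤ Real.exp 4 :=
      Real.exp_le_exp.2 (by nlinarith [Real.pi_le_four, Real.pi_pos, sq_nonneg α])
    have h4 : Real.exp 4 < 55 := by
      have h : Real.exp 4 = Real.exp 1 ^ 4 := by rw [← Real.exp_nat_mul]; norm_num
      rw [h]
      have h1 := Real.exp_one_lt_d9
      have h0 : 0 < Real.exp 1 := Real.exp_pos 1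
      calc Real.exp 1 ^ 4 < (2.7182818286 : ℝ) ^ 4 := by gcongr
        _ < 55 := by norm_num
    rw [Real.exp_neg, one_div]
    exact inv_anti₀ (Real.exp_pos _) (h1'.trans h4.le)
  obtain ⟨hlo, hhi⟩ := abs_sub_le_iff.1 herr
  unfold thresholdReadout
  constructor <;> nlinarith

/-! ### Lemma 3.6 for a threshold in the window and a readout `η`-close to the cosine -/

section Window

variable {ι : Type} [Fintype ι] [DecidableEq ι] (q K : ℕ) [NeZero q] [NeZero K]

/-- **Wrong candidate, window form**: readout `η`-close to the cosine (`η ≤ e^{-πα²}/16`, `|g| ≤ 1`), any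
threshold `θ ≥ (7/16)e^{-πα²}`: `Pr[accept s' ≠ s] ≤ exp(-N e^{-2πα²}/64)`. [cite: RegevLWE2009, Lemma 3.6] -/
theorem toReal_acceptStat_of_ne_le_window (χ : PMF (ZMod (q * K))) (α : ℝ) {s s' : ι → ZMod q} (h : s' ≠ s)
    (N : ℕ) {g : ZMod (q * K) → ℝ} {η θ : ℝ} (hg : ∀ k, |g k - ((ZMod.toCircle k : Circle) : ℂ).re| ≤ η)
    (hB : ∀ k, |g k| ≤ 1) (hη : η ≤ Real.exp (-(π * α ^ 2)) / 16)
    (hθ : 7 / 16 * Real.exp (-(π * α ^ 2)) ≤ θ) :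
    ((LWE.iidPMF (lweSampleK q K χ s) N).toOuterMeasure (acceptSetStat q K g N θ s')).toReal ≤
      Real.exp (-((N : ℝ) * Real.exp (-(2 * π * α ^ 2)) / 64)) := by
  have hE := Real.exp_pos (-(π * α ^ 2))
  have hηθ : η ≤ θ := by linarith
  refine (toReal_acceptStat_of_ne_le q K χ h N hg one_pos hB hηθ).trans ?_
  rw [Real.exp_le_exp, neg_le_neg_iff, one_pow, mul_one]
  have hgap : 3 * Real.exp (-(π * α ^ 2)) / 8 ≤ θ - η := by linarith
  have hg0 : 0 ≤ 3 * Real.exp (-(π * α ^ 2)) / 8 := by positivity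
  have hsq := pow_le_pow_left₀ hg0 hgap 2
  have hexp : Real.exp (-(2 * π * α ^ 2)) = Real.exp (-(π * α ^ 2)) ^ 2 := by
    rw [← Real.exp_nat_mul]; push_cast; ring_nf
  have hN : (0 : ℝ) ≤ N := Nat.cast_nonneg _
  rw [hexp]
  calc (N : ℝ) * Real.exp (-(π * α ^ 2)) ^ 2 / 64 ≤ (N : ℝ) * (3 * Real.exp (-(π * α ^ 2)) / 8) ^ 2 / 8 := by
        nlinarith [sq_nonneg (Real.exp (-(π * α ^ 2)))]
    _ ≤ (N : ℝ) * (θ - η) ^ 2 / 8 := by gcongr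

/-- **Right candidate, window form**: readout `η`-close to the cosine (`η ≤ e^{-πα²}/16`, `|g| ≤ 1`),
`χ = Ψ̄^{(qK)}_β` with `|β| ≤ α`, `4πe^{πα²} ≤ qK`, any threshold `θ ≤ e^{-πα²}/2`:
`Pr[reject s] ≤ exp(-N e^{-2πα²}/256)`. [cite: RegevLWE2009, Lemma 3.6] -/
theorem toReal_rejectStat_self_le_window {α β : ℝ} (hβ : |β| ≤ α)
    (hQ : 4 * π * Real.exp (π * α ^ 2) ≤ (q * K : ℕ)) (s : ι → ZMod q) (N : ℕ) {g : ZMod (q * K) → ℝ}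
    {η θ : ℝ} (hg : ∀ k, |g k - ((ZMod.toCircle k : Circle) : ℂ).re| ≤ η) (hB : ∀ k, |g k| ≤ 1)
    (hη : η ≤ Real.exp (-(π * α ^ 2)) / 16) (hθ : θ ≤ Real.exp (-(π * α ^ 2)) / 2) :
    ((LWE.iidPMF (lweSampleK q K (LWE.discretizedGaussian (q * K) β) s) N).toOuterMeasure
        (acceptSetStat q K g N θ s)ᶜ).toReal ≤
      Real.exp (-((N : ℝ) * Real.exp (-(2 * π * α ^ 2)) / 256)) := by
  have hgap0 := gap_le_cosMean_sub_threshold hβ hQ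
  have hthr : threshold α = Real.exp (-(π * α ^ 2)) / 2 := rfl
  have hgap : 3 * Real.exp (-(π * α ^ 2)) / 16 ≤
      cosMean (LWE.discretizedGaussian (q * K) β) - η - θ := by rw [hthr] at hgap0; linarith
  have hθ' : θ ≤ cosMean (LWE.discretizedGaussian (q * K) β) - η := by
    have := Real.exp_pos (-(π * α ^ 2)); linarith
  refine (toReal_rejectStat_self_le q K _ s N hg one_pos hB hθ').trans ?_
  rw [Real.exp_le_exp, neg_le_neg_iff, one_pow, mul_one]
  have hg0 : 0 ≤ 3 * Real.exp (-(π * α ^ 2)) / 16 := by positivity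
  have hsq := pow_le_pow_left₀ hg0 hgap 2
  have hexp : Real.exp (-(2 * π * α ^ 2)) = Real.exp (-(π * α ^ 2)) ^ 2 := by
    rw [← Real.exp_nat_mul]; push_cast; ring_nf
  have hN : (0 : ℝ) ≤ N := Nat.cast_nonneg _
  rw [hexp]
  calc (N : ℝ) * Real.exp (-(π * α ^ 2)) ^ 2 / 256 ≤ (N : ℝ) * (3 * Real.exp (-(π * α ^ 2)) / 16) ^ 2 / 8 := by
        nlinarith [sq_nonneg (Real.exp (-(π * α ^ 2)))]
    _ ≤ (N : ℝ) * (cosMean (LWE.discretizedGaussian (q * K) β) - η - θ) ^ 2 / 8 := by gcongr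

/-- `1/1000 ≤ e^{-πα²}/16` for `|α| ≤ 1` (hypothesis `hη` of the window forms with `η = 1/1000`). [folklore] -/
theorem one_div_thousand_le_exp_div_sixteen {α : ℝ} (hα : |α| ≤ 1) :
    (1 : ℝ) / 1000 ≤ Real.exp (-(π * α ^ 2)) / 16 := by
  have h := one_div_thousand_le_exp_div_eight hα
  have hα2 : α ^ 2 ≤ 1 := by
    have h := pow_le_one₀ (abs_nonneg α) hα (n := 2)
    rwa [sq_abs] at h
  have h1 : Real.exp (π * α ^ 2) ≤ Real.exp 4 :=
    Real.exp_le_exp.2 (by nlinarith [Real.pi_le_four, Real.pi_pos, sq_nonneg α])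
  have h4 : Real.exp 4 < 55 := by
    have h : Real.exp 4 = Real.exp 1 ^ 4 := by rw [← Real.exp_nat_mul]; norm_num
    rw [h]
    have h1 := Real.exp_one_lt_d9
    have h0 : 0 < Real.exp 1 := Real.exp_pos 1
    calc Real.exp 1 ^ 4 < (2.7182818286 : ℝ) ^ 4 := by gcongr
      _ < 55 := by norm_num
  have h55 : (1 : ℝ) / 55 ≤ (Real.exp (π * α ^ 2))⁻¹ := by
    rw [one_div]; exact inv_anti₀ (Real.exp_pos _) (h1.trans h4.le)
  rw [Real.exp_neg]
  linarith

end Window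

end Regev2009

end Literature.Computability.Cryptography
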